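import Summits.Ventures.WeilGRH.UniformConductorFloorJointCertSoundB
import Summits.Ventures.WeilGRH.UniformConductorFloorJointEvenCheck
import Summits.Ventures.WeilGRH.UniformConductorFloorJointOddCheck
import Summits.Ventures.WeilGRH.UniformConductorFloorCellsOne
import Summits.Ventures.WeilGRH.UniformConductorFloorRungs
import HarnessLib

/-!
# GRH arm (rh-explicit, venture WeilGRH): ★ Weil positivity on `[-1, 1]` for EVERY Dirichlet character of EVERY modulus
  `q ≥ 78` (odd characters: `q ≥ 31`) — the joint cell certificates

Cell `rh-explicit`, WEIL TRACK — GRH ARM (weil-grh-1).  The uniform `t = 1` conductor floor of the arm, from the JOINT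
(archimedean layers + primes) Collatz–Wielandt cell certificates `certEven320` / `certOdd320`
(`UniformConductorFloorJointData.lean`, kernel-checked in `…JointEvenCheck.lean` / `…JointOddCheck.lean`), the soundness theorem
`JointCert.weilPositivityOnChar_one_of_parts` (`…JointCertSoundB.lean`: the all-trivial pseudo-key form `T_M(|g|)` is
non-negative on `[-t, t]`, `t = 320 log(320/319) ≥ 1`, at conductor parameter `Q₀`, and it minorises `Re Q_χ(g)` for every
character of the parity), the tree's weights `w̄_n ≥ Λ(n)/√n` (`UniformFloor.wbar7_ge`) and digamma values
(`UniformFloor.psi_even_ge`, `psi_odd_ge`), and the elementary bounds `log 78 ≥ 4 log 3 − 3/78`, `log 31 ≥ 5 log 2 − 1/31`: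

* ★ `weilPositivityOnChar_one_of_ge_78` — **EVERY Dirichlet character (any parity, any values, imprimitive included) of EVERY
  modulus `q ≥ 78` satisfies `WeilPositivityOnChar χ 1`** (tree before: `q ≥ 144`, `UniformConductorFloorCellsEightyFloors`);
* ★ `weilPositivityOnChar_one_of_odd_ge_31` — every ODD character of every modulus `q ≥ 31` (tree before: `56`; `61` by the
  kernel route `DualTrigUniversalJointOneOdd`);
* `weilPositivityOnChar_of_le_one_of_ge_78` — the same on every window `t ≤ 1`.

Calibration: the cell's exact K(t)-closure floors of the pseudo-keys (EXTREMALS/GRH/trivial-key-minorant-CERT, weil-grh-2) are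
`75` / `30`; the 320-cell joint certificate loses `3` / `1` conductors (160 cells: `81` / `32`; the scheme converges to the exact
floors as `J → ∞`).  Honest scope: a finite-window (`t = 1`) statement for large moduli; nothing here is a step towards GRH for
any individual character; no `ζ` input; standard axioms; the certificates are kernel-checked integer data.

## References

* A. Weil (1952), (11) pp. 261–262 and the «lemme» p. 262 [Weil1952FormulesExplicites]; H. L. Montgomery, R. C. Vaughan (2007),
  (12.22) [MontgomeryVaughan2007]; L. Collatz (1942) / H. Wielandt (1950). [folklore]
-/

noncomputable section

open Real Set
open scoped ArithmeticFunction.vonMangoldt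

namespace Summit.Ventures.WeilGRH

open Literature.NumberTheory.LFunctions

namespace UniformFloor

variable {q : ℕ}

/-! ## The transcendental inputs -/

/-- The weights of `certEven320` dominate `Λ(n)/√n` (`W_n = ⌈2^20 w̄_n⌉` and `UniformFloor.wbar7_ge`). [folklore] -/
theorem certEven320_hw : ∀ n ∈ Finset.range (certEven320.N + 1), (Λ n : ℝ) / Real.sqrt n ≤ certEven320.wbar n := by
  intro n hn
  have hn8 : n < 8 := by simpa [show certEven320.N = 7 from rfl] using Finset.mem_range.1 hn
  refine (wbar7_ge 7 le_rfl n (Finset.mem_range.2 hn8)).trans ?_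
  unfold JointCert.wbar
  rw [show certEven320.D = 1048576 from rfl]
  interval_cases n
  · rw [show certEven320.weights.getD 0 0 = 0 from rfl]
    norm_num [wbar7]
  · rw [show certEven320.weights.getD 1 0 = 0 from rfl]
    norm_num [wbar7]
  · rw [show certEven320.weights.getD 2 0 = 513950 from rfl]
    norm_num [wbar7]
  · rw [show certEven320.weights.getD 3 0 = 665112 from rfl]
    norm_num [wbar7]
  · rw [show certEven320.weights.getD 4 0 = 363409 from rfl]
    norm_num [wbar7]
  · rw [show certEven320.weights.getD 5 0 = 754726 from rfl]
    norm_num [wbar7]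
  · rw [show certEven320.weights.getD 6 0 = 0 from rfl]
    norm_num [wbar7]
  · rw [show certEven320.weights.getD 7 0 = 771213 from rfl]
    norm_num [wbar7]

/-- The weights of `certOdd320` dominate `Λ(n)/√n`. [folklore] -/
theorem certOdd320_hw : ∀ n ∈ Finset.range (certOdd320.N + 1), (Λ n : ℝ) / Real.sqrt n ≤ certOdd320.wbar n := by
  intro n hn
  have hn8 : n < 8 := by simpa [show certOdd320.N = 7 from rfl] using Finset.mem_range.1 hn
  refine (wbar7_ge 7 le_rfl n (Finset.mem_range.2 hn8)).trans ?_
  unfold JointCert.wbar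
  rw [show certOdd320.D = 1048576 from rfl]
  interval_cases n
  · rw [show certOdd320.weights.getD 0 0 = 0 from rfl]
    norm_num [wbar7]
  · rw [show certOdd320.weights.getD 1 0 = 0 from rfl]
    norm_num [wbar7]
  · rw [show certOdd320.weights.getD 2 0 = 513950 from rfl]
    norm_num [wbar7]
  · rw [show certOdd320.weights.getD 3 0 = 665112 from rfl]
    norm_num [wbar7]
  · rw [show certOdd320.weights.getD 4 0 = 363409 from rfl]
    norm_num [wbar7]
  · rw [show certOdd320.weights.getD 5 0 = 754726 from rfl]
    norm_num [wbar7]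
  · rw [show certOdd320.weights.getD 6 0 = 0 from rfl]
    norm_num [wbar7]
  · rw [show certOdd320.weights.getD 7 0 = 771213 from rfl]
    norm_num [wbar7]

/-- `log 78 ≥ 4 log 3 − 3/78` (`78 = 81·(78/81)`, `log x ≤ x − 1`). [folklore] -/
theorem log_78_ge : 4 * Real.log 3 - 3 / 78 ≤ Real.log 78 := by
  have hl : Real.log ((81 : ℝ) / 78) ≤ 81 / 78 - 1 := Real.log_le_sub_one_of_pos (by norm_num)
  rw [Real.log_div (by norm_num) (by norm_num), show (81 : ℝ) = 3 ^ 4 by norm_num, Real.log_pow] at hl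
  push_cast at hl
  linarith

/-- `log 31 ≥ 5 log 2 − 1/31` (`31 = 32·(31/32)`). [folklore] -/
theorem log_31_ge : 5 * Real.log 2 - 1 / 31 ≤ Real.log 31 := by
  have hl : Real.log ((32 : ℝ) / 31) ≤ 32 / 31 - 1 := Real.log_le_sub_one_of_pos (by norm_num)
  rw [Real.log_div (by norm_num) (by norm_num), show (32 : ℝ) = 2 ^ 5 by norm_num, Real.log_pow] at hl
  push_cast at hl
  linarith

/-- The budget of `certEven320`: `log π + 4.22745354 − Clow/D + RHO/D ≤ log 78`. [folklore] -/
theorem certEven320_budget :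
    Real.log Real.pi - (-4.22745354) - (certEven320.Clow : ℝ) / certEven320.D + (certEven320.RHO : ℝ) / certEven320.D ≤
      Real.log (78 : ℕ) := by
  have hπ := Literature.Analysis.SpecialFunctions.Real.log_pi_le
  have h3 := Real.log_three_gt_d9
  have h78 := log_78_ge
  rw [show certEven320.Clow = 7676640 from rfl, show certEven320.D = 1048576 from rfl,
    show certEven320.RHO = 6610658 from rfl]
  push_cast
  linarith

/-- The budget of `certOdd320`: `log π + 1.08586154 − Clow/D + RHO/D ≤ log 31`. [folklore] -/
theorem certOdd320_budget :
    Real.log Real.pi - (-1.08586154) - (certOdd320.Clow : ℝ) / certOdd320.D + (certOdd320.RHO : ℝ) / certOdd320.D ≤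
      Real.log (31 : ℕ) := by
  have hπ := Literature.Analysis.SpecialFunctions.Real.log_pi_le
  have h2 := Real.log_two_gt_d9
  have h31 := log_31_ge
  rw [show certOdd320.Clow = 4399980 from rfl, show certOdd320.D = 1048576 from rfl,
    show certOdd320.RHO = 5656465 from rfl]
  push_cast
  linarith

/-! ## The floors -/

/-- ★ **Every EVEN Dirichlet character of every modulus `q ≥ 78` satisfies Weil positivity on `[-1, 1]`.** [folklore] -/
theorem weilPositivityOnChar_one_of_even_ge_78 (hq : 78 ≤ q) (χ : DirichletCharacter ℂ q) (hpar : charParity χ = 0) :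
    WeilPositivityOnChar χ 1 :=
  certEven320.weilPositivityOnChar_one_of_parts certEven320_checkFrame certEven320_checkOne
    (fun _ hj ↦ certEven320.cellOKB_of_checkCells certEven320_checkCells hj) certEven320_hw psi_even_ge
    (Q₀ := 78) (by norm_num) certEven320_budget (by omega) hq χ hpar

/-- ★ **Every ODD Dirichlet character of every modulus `q ≥ 31` satisfies Weil positivity on `[-1, 1]`.**
[cite: Weil1952FormulesExplicites, (11) and the «lemme» p. 262] -/
theorem weilPositivityOnChar_one_of_odd_ge_31 (hq : 31 ≤ q) (χ : DirichletCharacter ℂ q) (hpar : charParity χ = 1) :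
    WeilPositivityOnChar χ 1 :=
  certOdd320.weilPositivityOnChar_one_of_parts certOdd320_checkFrame certOdd320_checkOne
    (fun _ hj ↦ certOdd320.cellOKB_of_checkCells certOdd320_checkCells hj) certOdd320_hw psi_odd_ge
    (Q₀ := 31) (by norm_num) certOdd320_budget (by omega) hq χ hpar

/-- ★★ **EVERY Dirichlet character (any parity, any values, imprimitive included) of EVERY modulus `q ≥ 78` satisfies Weil
positivity on `[-1, 1]`: `WeilPositivityOnChar χ 1`.** [cite: Weil1952FormulesExplicites, (11) and the «lemme» p. 262] -/
theorem weilPositivityOnChar_one_of_ge_78 (hq : 78 ≤ q) (χ : DirichletCharacter ℂ q) : WeilPositivityOnChar χ 1 := by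
  rcases Nat.le_one_iff_eq_zero_or_eq_one.1 (charParity_le_one χ) with h | h
  · exact weilPositivityOnChar_one_of_even_ge_78 hq χ h
  · exact weilPositivityOnChar_one_of_odd_ge_31 (by omega) χ h

/-- The same on every window `t ≤ 1`. [folklore] -/
theorem weilPositivityOnChar_of_le_one_of_ge_78 (hq : 78 ≤ q) (χ : DirichletCharacter ℂ q) {t : ℝ} (ht : t ≤ 1) :
    WeilPositivityOnChar χ t := fun g hg hsupp ↦
  weilPositivityOnChar_one_of_ge_78 hq χ g hg (hsupp.trans (Icc_subset_Icc (by linarith) ht))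

/-- Odd characters on every window `t ≤ 1` from `q ≥ 31`. [folklore] -/
theorem weilPositivityOnChar_of_le_one_of_odd_ge_31 (hq : 31 ≤ q) (χ : DirichletCharacter ℂ q) (hpar : charParity χ = 1)
    {t : ℝ} (ht : t ≤ 1) : WeilPositivityOnChar χ t := fun g hg hsupp ↦
  weilPositivityOnChar_one_of_odd_ge_31 hq χ hpar g hg (hsupp.trans (Icc_subset_Icc (by linarith) ht))

end UniformFloor

end Summit.Ventures.WeilGRH

end
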